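import Literature.NumberTheory.Automorphic.TorusEigenvalueAlgebraic
import Literature.NumberTheory.Automorphic.CentralEigensystemComplex
import Mathlib.LinearAlgebra.FreeModule.IdealQuotient
import HarnessLib

/-!
# The `t^B_2`-eigensystem on the Borel stratum of a Bianchi group is a Größencharakter

Topic `NumberTheory/Automorphic`; namespace `Literature.NumberTheory.Automorphic.ParallelWeight`.
Theorems only.

Transport of `TorusEigenvalueAlgebraic.exists_torus_exponents` through `ι : E ≃+* ℂ` and the
standard argument "admissible elements generate the ray modulo `𝔫`": for `F` imaginary quadratic,
`𝔫 ≠ 0` neat, `S ⊇ {v ∣ 𝔫}` finite and `y₀ ≠ 0` in the Borel model at level `K_f(𝔫) ∩ H_S` with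
`T^B_{e₂,w} y₀ = μ_w y₀`, `μ_w ≠ 0` (`w ∉ S`), the function `w ↦ ι (μ w)` is an algebraic
Größencharakter of conductor dividing `𝔫 ∏_{w ∈ S} w` (`isGrossencharakter_torusEigensystem`):
if `M(x) = ∏_{w ∣ x} μ_w^{ord_w x}` and `Ω(x) = ∏_σ σ(x)^{e_σ}` agree on admissible `x`, then for
`b ≡ c mod 𝔣`, `(c) + 𝔣 = 1` and `h = #(𝓞/𝔫)ˣ` the elements `c^h` and `b c^{h-1}` are admissible, so
`M(c)^h = Ω(c)^h`, `M(b) M(c)^{h-1} = Ω(b) Ω(c)^{h-1}` and `M(b) Ω(c) = M(c) Ω(b)`.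
[cite: Harder1987, §2, (2.7)–(2.8)]

## References

* G. Harder, *Eisenstein cohomology of arithmetic groups. The case GL₂*, Invent. Math. 89 (1987), §2.
  [Harder1987]
* J. Neukirch, *Algebraic Number Theory* (1999), Ch. VII §6. [NeukirchANT1999]
-/

noncomputable section

open scoped NumberField ComplexConjugate
open IsDedekindDomain NumberField

namespace Literature.NumberTheory.Automorphic.ParallelWeight

open BigHeckeGLn GLnCohomology Literature.NumberTheory.GaloisRepresentations

variable {F : Type} [Field F] [NumberField F]

/-! ### Arithmetic preliminaries -/

/-- For `(c) + 𝔫 = 1`, `𝔫 ≠ 0`: `c^h ≡ 1 mod 𝔫` with `h = #(𝓞_F/𝔫)ˣ ≥ 1`. [folklore] -/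
theorem exists_pow_sub_one_mem {𝔫 : Ideal (𝓞 F)} (h𝔫 : 𝔫 ≠ ⊥) {c : 𝓞 F}
    (hc : IsCoprime (Ideal.span {c}) 𝔫) : ∃ h : ℕ, 0 < h ∧ c ^ h - 1 ∈ 𝔫 := by
  haveI : Finite (𝓞 F ⧸ 𝔫) := Ideal.finiteQuotientOfFreeOfNeBot 𝔫 h𝔫
  -- `c` is a unit modulo `𝔫`
  obtain ⟨r, s, hs, hrs⟩ : ∃ r : 𝓞 F, ∃ s ∈ 𝔫, r * c + s = 1 := by
    have htop : Ideal.span {c} ⊔ 𝔫 = ⊤ := Ideal.isCoprime_iff_sup_eq.1 hc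
    have h1 : (1 : 𝓞 F) ∈ Ideal.span {c} ⊔ 𝔫 := by rw [htop]; exact Submodule.mem_top
    obtain ⟨a, ha, s, hs, has⟩ := Submodule.mem_sup.1 h1
    obtain ⟨r, rfl⟩ := Ideal.mem_span_singleton'.1 ha
    exact ⟨r, s, hs, has⟩
  have hmul : Ideal.Quotient.mk 𝔫 c * Ideal.Quotient.mk 𝔫 r = 1 := by
    rw [← map_mul, mul_comm]
    have : Ideal.Quotient.mk 𝔫 (r * c + s) = 1 := by rw [hrs, map_one]
    rwa [map_add, Ideal.Quotient.eq_zero_iff_mem.2 hs, add_zero] at this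
  have hunit : IsUnit (Ideal.Quotient.mk 𝔫 c) := IsUnit.of_mul_eq_one _ hmul
  refine ⟨Nat.card (𝓞 F ⧸ 𝔫)ˣ, Nat.card_pos, ?_⟩
  rw [← Ideal.Quotient.eq, map_pow, map_one]
  have h : hunit.unit ^ Nat.card (𝓞 F ⧸ 𝔫)ˣ = 1 := pow_card_eq_one'
  rw [Units.ext_iff, Units.val_pow_eq_pow_val, IsUnit.unit_spec, Units.val_one] at h
  exact h

/-- Prime factors of a power. [folklore] -/
theorem dvd_span_of_dvd_span_pow {w : HeightOneSpectrum (𝓞 F)} {c : 𝓞 F} {k : ℕ}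
    (h : w.asIdeal ∣ Ideal.span {c ^ k}) : w.asIdeal ∣ Ideal.span {c} := by
  rw [← Ideal.span_singleton_pow] at h
  exact w.prime.dvd_of_dvd_pow h

/-- Prime factors of a product. [folklore] -/
theorem dvd_span_or_of_dvd_span_mul {w : HeightOneSpectrum (𝓞 F)} {b c : 𝓞 F}
    (h : w.asIdeal ∣ Ideal.span {b * c}) : w.asIdeal ∣ Ideal.span {b} ∨ w.asIdeal ∣ Ideal.span {c} := by
  rw [← Ideal.span_singleton_mul_span_singleton] at h
  exact w.prime.dvd_or_dvd h

/-! ### The algebraic character `Ω(x) = ∏_σ σ(x)^{e_σ}` -/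

/-- `Ω(x) = ∏_σ σ(x)^{e_σ}`. [folklore] -/
def algChar (e : (F →+* ℂ) → ℤ) (x : F) : ℂ := ∏ σ : F →+* ℂ, σ x ^ e σ

/-- `Ω` is multiplicative. [folklore] -/
theorem algChar_mul (e : (F →+* ℂ) → ℤ) (x y : F) :
    algChar e (x * y) = algChar e x * algChar e y := by
  rw [algChar, algChar, algChar, ← Finset.prod_mul_distrib]
  exact Finset.prod_congr rfl fun σ _ => by rw [map_mul, mul_zpow]

/-- `Ω(x^k) = Ω(x)^k`. [folklore] -/
theorem algChar_pow (e : (F →+* ℂ) → ℤ) (x : F) (k : ℕ) : algChar e (x ^ k) = algChar e x ^ k := by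
  rw [algChar, algChar, ← Finset.prod_pow]
  exact Finset.prod_congr rfl fun σ _ => by rw [map_pow, ← zpow_natCast, ← zpow_mul, mul_comm, zpow_mul, zpow_natCast]

/-- `Ω(x) ≠ 0` for `x ≠ 0`. [folklore] -/
theorem algChar_ne_zero (e : (F →+* ℂ) → ℤ) {x : F} (hx : x ≠ 0) : algChar e x ≠ 0 :=
  Finset.prod_ne_zero_iff.2 fun σ _ => zpow_ne_zero _ ((map_ne_zero σ).2 hx)

/-- `Ω(b)/Ω(c) = ∏_w w(b/c)^{e(w)} \overline{w(b/c)}^{e(w̄)}` in a totally complex field. [folklore] -/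
theorem algChar_div_eq_prod_infinitePlace [IsTotallyComplex F] (e : (F →+* ℂ) → ℤ) (b c : F) :
    algChar e b / algChar e c =
      ∏ w : InfinitePlace F, w.embedding (b / c) ^ e w.embedding *
        conj (w.embedding (b / c)) ^ e (ComplexEmbedding.conjugate w.embedding) := by
  have hdiv : algChar e b / algChar e c = ∏ σ : F →+* ℂ, σ (b / c) ^ e σ := by
    rw [algChar, algChar, ← Finset.prod_div_distrib]
    exact Finset.prod_congr rfl fun σ _ => by rw [map_div₀, div_zpow]
  rw [hdiv, prod_embeddings_eq_prod_infinitePlace]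
  refine Finset.prod_congr rfl fun w _ => ?_
  rw [InfinitePlace.mult, if_neg (InfinitePlace.not_isReal_iff_isComplex.2 (IsTotallyComplex.isComplex w)),
    show 2 - 1 = 1 from rfl, pow_one]
  rfl

/-! ### The main theorem -/

section Main

variable (E : Type) [Field E] [CharZero E] [IsAlgClosed E] (wt : Fin 2 → ℤ)

omit [CharZero E] [IsAlgClosed E] in
/-- `ι (∏_{w ∣ x} μ_w^{ord_w x}) = idealPow (ι ∘ μ) (x)` for the list product of
`TorusEigenvalueAlgebraic`. [folklore] -/
theorem map_listProd_eq_idealPow (ι : E ≃+* ℂ) (μ : HeightOneSpectrum (𝓞 F) → E) (x : 𝓞 F) (hx : x ≠ 0) :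
    ι (((suppOf x hx).toList.map fun w => μ w ^ ordAt w x).prod) =
      LFunctions.idealPow F (fun w => ι (μ w)) (Ideal.span {x}) :=
  map_eigenvalueProd ι μ x hx

/-- **The `t^B_2`-eigensystem is an algebraic Größencharakter.**  See the module docstring.
[cite: Harder1987, §2, (2.7)–(2.8)] -/
theorem isGrossencharakter_torusEigensystem [IsTotallyComplex F] (ι : E ≃+* ℂ)
    (hF : Module.finrank ℚ F = 2) {𝔫 : Ideal (𝓞 F)} (h𝔫 : 𝔫 ≠ 0)
    (hneat : ∀ a : F, (∀ v : HeightOneSpectrum (𝓞 F), v.valuation F a ≤ 1) →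
      (∀ v : HeightOneSpectrum (𝓞 F), v.valuation F a⁻¹ ≤ 1) →
      (∀ v : HeightOneSpectrum (𝓞 F), v.valuation F (a - 1) ≤ idealRadius F v 𝔫) → a = 1)
    {S : Set (HeightOneSpectrum (𝓞 F))} (hS : S.Finite)
    (hS𝔫 : ∀ v : HeightOneSpectrum (𝓞 F), v.asIdeal ∣ 𝔫 → v ∈ S) (q : ℕ)
    {y₀ : TwistedQuotient.cohomology (borelToAwayFrom F S) (levelH S 𝔫) (borelCoeffRep E wt) q}
    (hy₀ : y₀ ≠ 0) (μ : HeightOneSpectrum (𝓞 F) → E)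
    (hμ : ∀ w, w ∉ S → TwistedQuotient.heckeEnd (borelToAwayFrom F S) (levelH S 𝔫)
      (borelCoeffRep E wt) (borelHeckeElement₂ S w) q y₀ = μ w • y₀)
    (hμ0 : ∀ w, w ∉ S → μ w ≠ 0) :
    ∃ e : (F →+* ℂ) → ℤ, IsGrossencharakter (conductorOf 𝔫 hS) (fun w => e w.embedding)
      (fun w => e (ComplexEmbedding.conjugate w.embedding)) (fun w => ι (μ w)) := by
  classical
  obtain ⟨e, he⟩ := exists_torus_exponents E wt hF h𝔫 hneat hS𝔫 q hy₀ μ hμ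
  -- transport the exponents along `ι`
  let e' : (F →+* ℂ) → ℤ := fun σ => e ((embEquiv ι).symm σ)
  -- `idealPow (ι ∘ μ) (x) = Ω(x)` on admissible `x`
  have hadm : ∀ (x : 𝓞 F) (hx : x ≠ 0), x - 1 ∈ 𝔫 → (∀ w ∈ S, ¬ w.asIdeal ∣ Ideal.span {x}) →
      LFunctions.idealPow F (fun w => ι (μ w)) (Ideal.span {x}) = algChar e' (x : F) := by
    intro x hx hx1 hxS
    rw [← map_listProd_eq_idealPow E ι μ x hx, he x hx hx1 hxS, map_prod, algChar]
    refine Fintype.prod_equiv (embEquiv ι) _ _ fun τ => ?_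
    have hτ : (embEquiv (F := F) ι τ) (x : F) = ι (τ x) := rfl
    rw [hτ, map_zpow₀]
    simp only [e', Equiv.symm_apply_apply]
  -- non-vanishing of `idealPow` off `S`
  have hP0 : ∀ (x : 𝓞 F) (hx : x ≠ 0), (∀ w, w.asIdeal ∣ Ideal.span {x} → w ∉ S) →
      LFunctions.idealPow F (fun w => ι (μ w)) (Ideal.span {x}) ≠ 0 := by
    intro x hx hxS
    rw [← map_listProd_eq_idealPow E ι μ x hx, map_ne_zero]
    refine List.prod_ne_zero fun h0 => ?_
    obtain ⟨w, hw, hw0⟩ := List.mem_map.1 h0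
    exact pow_ne_zero _ (hμ0 w (hxS w ((mem_suppOf hx).1 (Finset.mem_toList.1 hw)))) hw0
  refine ⟨e', fun v hv => ?_, fun b c hb hc hcop hbc _ => ?_⟩
  · rw [map_ne_zero]
    exact hμ0 v (not_mem_and_not_dvd_of_not_le hS hv).1
  · -- the prime factors of `b` and `c` avoid `S` and `𝔫`
    have hcS : ∀ w : HeightOneSpectrum (𝓞 F), w.asIdeal ∣ Ideal.span {c} → w ∉ S ∧ ¬ w.asIdeal ∣ 𝔫 :=
      fun w hw => not_mem_and_not_dvd_of_not_le hS (not_le_of_dvd_span_of_isCoprime hcop hw)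
    have hbS : ∀ w : HeightOneSpectrum (𝓞 F), w.asIdeal ∣ Ideal.span {b} → w ∉ S ∧ ¬ w.asIdeal ∣ 𝔫 := by
      intro w hw
      refine not_mem_and_not_dvd_of_not_le hS fun hle => ?_
      refine not_le_of_dvd_span_of_isCoprime hcop (w := w) ?_ hle
      rw [Ideal.dvd_span_singleton]
      have hb' : b ∈ w.asIdeal := Ideal.dvd_span_singleton.1 hw
      have : b - (b - c) ∈ w.asIdeal := sub_mem hb' (hle hbc)
      rwa [sub_sub_cancel] at this
    have hbc' : b - c ∈ 𝔫 := Ideal.mul_le_right hbc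
    -- `c^h ≡ 1 mod 𝔫`
    have hcop𝔫 : IsCoprime (Ideal.span {c}) 𝔫 :=
      hcop.of_isCoprime_of_dvd_right (dvd_mul_right 𝔫 _)
    obtain ⟨h, hpos, hch⟩ := exists_pow_sub_one_mem h𝔫 hcop𝔫
    -- the admissible elements `x₁ = c^h`, `x₂ = b c^{h-1}`
    have hx₁ : c ^ h ≠ 0 := pow_ne_zero _ hc
    have hx₂ : b * c ^ (h - 1) ≠ 0 := mul_ne_zero hb (pow_ne_zero _ hc)
    have hx₁S : ∀ w ∈ S, ¬ w.asIdeal ∣ Ideal.span {c ^ h} :=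
      fun w hw hd => (hcS w (dvd_span_of_dvd_span_pow hd)).1 hw
    have hx₂S : ∀ w ∈ S, ¬ w.asIdeal ∣ Ideal.span {b * c ^ (h - 1)} := by
      intro w hw hd
      rcases dvd_span_or_of_dvd_span_mul hd with hd | hd
      · exact (hbS w hd).1 hw
      · exact (hcS w (dvd_span_of_dvd_span_pow hd)).1 hw
    have hx₂1 : b * c ^ (h - 1) - 1 ∈ 𝔫 := by
      have hsplit : b * c ^ (h - 1) - 1 = (b - c) * c ^ (h - 1) + (c ^ h - 1) := by
        have : c ^ h = c * c ^ (h - 1) := by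
          rw [← pow_succ']; congr 1; omega
        rw [this]; ring
      rw [hsplit]
      exact add_mem (Ideal.mul_mem_right _ _ hbc') hch
    have E1 := hadm (c ^ h) hx₁ hch hx₁S
    have E2 := hadm (b * c ^ (h - 1)) hx₂ hx₂1 hx₂S
    -- `idealPow` and `Ω` are multiplicative
    have hspan_c : Ideal.span {c} ≠ ⊥ := by rwa [Ne, Ideal.span_singleton_eq_bot]
    have hspan_b : Ideal.span {b} ≠ ⊥ := by rwa [Ne, Ideal.span_singleton_eq_bot]
    have hcF : (c : F) ≠ 0 := by exact_mod_cast hc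
    have hcoe₁ : ((c ^ h : 𝓞 F) : F) = (c : F) ^ h := by push_cast; rfl
    have hcoe₂ : ((b * c ^ (h - 1) : 𝓞 F) : F) = (b : F) * (c : F) ^ (h - 1) := by push_cast; rfl
    rw [← Ideal.span_singleton_pow, LFunctions.idealPow_pow _ hspan_c, hcoe₁, algChar_pow] at E1
    rw [← Ideal.span_singleton_mul_span_singleton, ← Ideal.span_singleton_pow,
      LFunctions.idealPow_mul _ hspan_b (pow_ne_zero _ hspan_c), LFunctions.idealPow_pow _ hspan_c, hcoe₂,
      algChar_mul, algChar_pow] at E2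
    set P := LFunctions.idealPow F (fun w => ι (μ w)) (Ideal.span {c}) with hP
    set Q := LFunctions.idealPow F (fun w => ι (μ w)) (Ideal.span {b}) with hQ
    set W := algChar e' (c : F) with hW
    set V := algChar e' (b : F) with hV
    have hW0 : W ≠ 0 := algChar_ne_zero e' hcF
    have hPh : P ^ h = P ^ (h - 1) * P := by
      rw [← pow_succ]; congr 1; omega
    have hWh : W ^ h = W ^ (h - 1) * W := by
      rw [← pow_succ]; congr 1; omega
    have key : Q * W * W ^ h = P * V * W ^ h := by
      calc Q * W * W ^ h = Q * W * P ^ h := by rw [E1]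
        _ = Q * P ^ (h - 1) * P * W := by rw [hPh]; ring
        _ = V * W ^ (h - 1) * P * W := by rw [E2]
        _ = P * V * (W ^ (h - 1) * W) := by ring
        _ = P * V * W ^ h := by rw [← hWh]
    have key' : Q * W = P * V := mul_right_cancel₀ (pow_ne_zero h hW0) key
    -- conclude
    show Q = P * ∏ w : InfinitePlace F, w.embedding ((b : F) / c) ^ e' w.embedding *
      conj (w.embedding ((b : F) / c)) ^ e' (ComplexEmbedding.conjugate w.embedding)
    rw [← algChar_div_eq_prod_infinitePlace e' (b : F) (c : F), mul_div_assoc', eq_div_iff hW0, key']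

end Main

end Literature.NumberTheory.Automorphic.ParallelWeight
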